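import Summits.Schanuel.Schanuel.Theorems.RootDecomp1BFedFlagCore
import Summits.Schanuel.Schanuel.Theorems.RootDecomp1BAutonomySplit

/-!
# RootDecomp1B — round 7 (lens-4 gen 7 «PolarFlag»): the fed coupling reduced along its fed direction

Port target: `lean/Summits/Schanuel/Schanuel/Theorems/RootDecomp1BFedFlag.lean`
(`--supports stmt-Schanuel-30165` = `RootDecomp1B.BaseFedCoupling`).

Over the LIVE route constants of `Theses/RootDecomp1B.lean` (rev ≥ 16: `BaseFedCoupling` 30165,
`NoAutonomousSlackFirstFailure` 30166, `NoSlackFirstFailure` 29189) and the Theses-independent kernel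
`Theorems/RootDecomp1BFedFlagCore.lean` (local statements `FedSharpStep`, `FedSurplusOneStep`,
`FedKleinPolar`; kernel `fedKleinPolar_of_flag_steps` = re-base + flag tower law + first-failure normal form):

* `baseFedCoupling_of_fedKleinPolar` / `baseFedCoupling_of_flag_steps` :
  `FedSharpStep → FedSurplusOneStep → RootDecomp1B.BaseFedCoupling` — THE ROUND-7 TRANSFER (critic F3 (iii));
* `noSlackFirstFailure_of_flag_steps_autonomy` : composed with the landed round-6 cut
  (`RootDecomp1BAutonomySplit.noSlackFirstFailure_of_autonomy`) it reaches the round-5 residual 29189.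

This file defines nothing; no transcendence input; 0 sorry.
-/

set_option linter.dupNamespace false

namespace Summit.Schanuel.Schanuel.Theorems.RootDecomp1BFedFlag

open Summit.Schanuel.Schanuel.Theses.RootDecomp1B (BaseFedCoupling NoAutonomousSlackFirstFailure NoSlackFirstFailure)

/-- `FedKleinPolar` (Klein-polar Schanuel at fed tuples, local statement of the core file) implies the route's
`BaseFedCoupling` (30165): the latter only adds hypotheses (budget / both sides dependent / slack) and weakens nothing. -/
theorem baseFedCoupling_of_fedKleinPolar (h : RootDecomp1BFedFlagCore.FedKleinPolar) : BaseFedCoupling := by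
  intro m r hr hIH _ _ _ _ hfed _
  exact h m r hr hIH hfed

/-- THE ROUND-7 TRANSFER: `FedSharpStep → FedSurplusOneStep → BaseFedCoupling` (length reduction along the fed
direction: `RootDecomp1BFedFlagCore.fedKleinPolar_of_flag_steps`). -/
theorem baseFedCoupling_of_flag_steps (hS : RootDecomp1BFedFlagCore.FedSharpStep)
    (h1 : RootDecomp1BFedFlagCore.FedSurplusOneStep) : BaseFedCoupling :=
  baseFedCoupling_of_fedKleinPolar (RootDecomp1BFedFlagCore.fedKleinPolar_of_flag_steps hS h1)

/-- Rounds 6 + 7 composed: the two flag steps and the autonomous residual give the round-5 residual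
`NoSlackFirstFailure` (29189). -/
theorem noSlackFirstFailure_of_flag_steps_autonomy (hS : RootDecomp1BFedFlagCore.FedSharpStep)
    (h1 : RootDecomp1BFedFlagCore.FedSurplusOneStep) (hA : NoAutonomousSlackFirstFailure) : NoSlackFirstFailure :=
  RootDecomp1BAutonomySplit.noSlackFirstFailure_of_autonomy (baseFedCoupling_of_flag_steps hS h1) hA

end Summit.Schanuel.Schanuel.Theorems.RootDecomp1BFedFlag
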